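import Mathlib
import Summits.NavierStokesRegularity.NavierStokesRegularity.Theorems.EulerZoomLiouvillePowerGaugeEulerLiouvilleDriftClockScale
import Summits.NavierStokesRegularity.NavierStokesRegularity.Theorems.EulerZoomLiouvillePowerGaugeEulerLiouvilleNeedleFastTime
import HarnessLib

/-!
# LINE `last_exit`, STUB LE1 `stub_stayersReturn`: «STAYERS RETURN» — under no far hovering and a Bernoulli bound, a lingering vortical high label revisits the near ball in every long window
# (crux `EulerZoomLiouville.PowerGaugeEulerLiouville` = stmt-NavierStokesRegularity-19832, THE ONE STATEMENT `stub_selfSimilarC2Needle`; line `Cruxes/PowerGaugeEulerLiouville/Lines/last_exit.lean` (ns-idea-11 g8), registered stub LE1)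

Route `EulerZoomLiouville` (NavierStokesRegularity), crux E; width seat ns-ezl-w1 g6 (free hand; the ideator's offer «LE1/LE2a/LE2b are free P-class targets»).
The statement below is `Sig.stub_stayersReturn` of the line file with its reducible abbreviation `NoFarHovering` δ-unfolded, so the skeleton fills LE1 by
`exact LastExit.stayersReturn`.  Setting: `C²` classical profile `(V, P′)` at rate `γ = 1/(2+ρ)`, `0 < ρ ≤ ½`; `W y = γy + V y`; `ℋ = ℋ_{P′}` the
Bernoulli function; NO FAR HOVERING above `h`: `‖W y‖ ≥ w₀ > 0` at every vortical point of `{ℋ > h}` with `‖y‖ ≥ R₁`; `m` bounds `ℋ` at the vortical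
points of `{ℋ > h} ∩ B̄(0,2R)`; `D ≥ 0` with `m − h ≤ (1−2γ)w₀²D`; `V′` a `C²` globally Lipschitz cut-off copy of `V` on `ball 0 R_big ⊋ B̄(0,2R)`.
CLAIM: a vortical label `y` with `ℋ(y) > h` whose backward `W_{V′}`-orbit stays in `B̄(0,2R)` on `[0,T]` is inside `B(0,R₁)` at some time of every window
`[a, a+D] ⊆ [0,T]`.
PROOF.  The orbit `Y t = Φ′_{−t} y` is a `V`-arc on `[0,T]` (it stays where `V′ = V`); it is Bernoulli-high (`ChannelClock.bernoulli_le_of_arc`) and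
vortical (`OutflowDive.vorticityTransport`) throughout.  If it stayed outside `B(0,R₁)` on `[a, a+D]`, no far hovering would give `‖W(Y)‖ ≥ w₀` there,
so by CIV (3.31) (`NeedleClock.bernoulli_comp_sub_eq_of_Icc`) `ℋ(Y(a+D)) − ℋ(Y a) = (1−2γ)∫_a^{a+D}‖W(Y)‖² ≥ (1−2γ)w₀²D ≥ m − h`; with `ℋ(Y a) > h`
this puts `ℋ(Y(a+D)) > m` at a vortical high point of `B̄(0,2R)` — contradicting the bound `m`.

* **`LastExit.stayersReturn`** — LE1, signature verbatim (unfolded).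

WHAT THIS IS NOT: not NS, not E — one registered PROVABLE stub of a filed line, `--supports` stmt-19832; the line's faces (`stub_hoverFace` = T-E,
`stub_spikeFace`) stay OPEN; the crux is OPEN; NS regularity is NOT proved; no summit statement is proved by this seat.
[folklore; ConstantinIgnatovaVicol2026Putative §3.4.3 (3.31), §3.5]
-/

noncomputable section

-- flat `Theorems/<Route><Decl>…` files of one crux share the namespace of the crux (tree convention: `Summit.<S>.<S>.…`)
set_option linter.dupNamespace false

open Set Filter Topology Metric MeasureTheory
open scoped RealInnerProductSpace ENNReal

namespace Summit.NavierStokesRegularity.NavierStokesRegularity.Theorems.PowerGaugeEulerLiouville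

open Literature.Analysis Literature.Analysis.FluidPDE

namespace LastExit

open ChannelClock

/-- **LE1 «STAYERS RETURN»** (`Sig.stub_stayersReturn` of `Lines/last_exit.lean`, `NoFarHovering` unfolded): under no far hovering above `h` (floor `w₀ > 0`
beyond `R₁`) and a bound `m` for `ℋ` on the vortical points of `{ℋ > h} ∩ B̄(0,2R)` with `m − h ≤ (1−2γ)w₀²D`, `D ≥ 0`, a vortical label of `{ℋ > h}` whose
backward cut-off orbit stays in `B̄(0,2R)` on `[0,T]` is inside `B(0,R₁)` at some time of every window `[a, a+D] ⊆ [0,T]`.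
[folklore; ConstantinIgnatovaVicol2026Putative §3.4.3 (3.31), §3.5] -/
theorem stayersReturn :
    ∀ ρ : ℝ, 0 < ρ → ρ ≤ 1 / 2 →
    ∀ (V : EuclideanSpace ℝ (Fin 3) → EuclideanSpace ℝ (Fin 3)) (P' : EuclideanSpace ℝ (Fin 3) → ℝ), ContDiff ℝ 2 V →
      IsSelfSimilarEulerProfile (1 / (2 + ρ)) 0 V P' →
      ∀ (h w₀ R₁ : ℝ), 0 < w₀ →
        (∀ y : EuclideanSpace ℝ (Fin 3), R₁ ≤ ‖y‖ →
          h < selfSimilarBernoulli (1 / (2 + ρ)) 0 V P' y → curl V y ≠ 0 →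
            w₀ ≤ ‖selfSimilarTransport (1 / (2 + ρ)) 0 V y‖) →
      ∀ (R m D : ℝ),
        (∀ z : EuclideanSpace ℝ (Fin 3), ‖z‖ ≤ 2 * R → curl V z ≠ 0 →
          h < selfSimilarBernoulli (1 / (2 + ρ)) 0 V P' z → selfSimilarBernoulli (1 / (2 + ρ)) 0 V P' z ≤ m) →
        m - h ≤ (1 - 2 * (1 / (2 + ρ))) * w₀ ^ 2 * D → 0 ≤ D →
      ∀ (V' : EuclideanSpace ℝ (Fin 3) → EuclideanSpace ℝ (Fin 3)) (K Rbig : ℝ), ContDiff ℝ 2 V' →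
        (∀ y, ‖fderiv ℝ V' y‖ ≤ K) → 2 * R < Rbig →
        (∀ w ∈ ball (0 : EuclideanSpace ℝ (Fin 3)) Rbig, V' w = V w) →
      ∀ (y : EuclideanSpace ℝ (Fin 3)) (T : ℝ), curl V y ≠ 0 →
        h < selfSimilarBernoulli (1 / (2 + ρ)) 0 V P' y →
        (∀ σ ∈ Icc 0 T, ‖ODE.evolutionMap (fun _ : ℝ => selfSimilarTransport (1 / (2 + ρ)) 0 V') 0 (-σ) y‖ ≤ 2 * R) →
        ∀ a : ℝ, 0 ≤ a → a + D ≤ T →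
          ∃ σ ∈ Icc a (a + D), ‖ODE.evolutionMap (fun _ : ℝ => selfSimilarTransport (1 / (2 + ρ)) 0 V') 0 (-σ) y‖ < R₁ := by
  intro ρ hρ hρh V P' hU2 hprof h w₀ R₁ hw₀ hnohov R m D hbound hmD hD V' K Rbig hV' hK' hRbig hagree' y T hy hhy hstay a ha haD
  set γ : ℝ := 1 / (2 + ρ) with hγdef
  have h2ρ : (0 : ℝ) < 2 + ρ := by linarith
  have hγ2 : γ < 1 / 2 := one_div_lt_one_div_of_lt two_pos (by linarith)
  have h12γ : 0 < 1 - 2 * γ := by linarith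
  by_contra hnot
  push Not at hnot
  -- `hnot : ∀ σ ∈ Icc a (a + D), R₁ ≤ ‖Φ′ (−σ) y‖`
  -- ### the cut-off orbit is a `V`-arc on `[0, T]`
  have hV'1 : ContDiff ℝ 1 V' := hV'.of_le (by norm_num)
  have hW'eq : ∀ z : EuclideanSpace ℝ (Fin 3), ‖z‖ < Rbig → selfSimilarTransport γ 0 V' z = selfSimilarTransport γ 0 V z := by
    intro z hz
    simp only [selfSimilarTransport_apply, hagree' z (by rwa [mem_ball, dist_zero_right])]
  set Φ' := ODE.evolutionMap (fun _ : ℝ => selfSimilarTransport γ 0 V') 0 with hΦ'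
  set Y : ℝ → EuclideanSpace ℝ (Fin 3) := fun t => Φ' (-t) y with hYdef
  have hYd : ∀ t, HasDerivAt Y ((-1 : ℝ) • selfSimilarTransport γ 0 V' (Y t)) t :=
    fun t => C2.Kelvin.hasDerivAt_flow_neg (γ := γ) hV'1 hK' y t
  have hYc : Continuous Y := continuous_iff_continuousAt.2 fun t => (hYd t).continuousAt
  have hY0 : Y 0 = y := by simp [hYdef, hΦ', ODE.evolutionMap_self]
  have haDT : a + D ≤ T := haD
  have hYV : ∀ t ∈ Icc 0 (a + D), HasDerivAt Y (-(selfSimilarTransport γ 0 V (Y t))) t := by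
    intro t ht
    have hn : ‖Y t‖ ≤ 2 * R := hstay t ⟨ht.1, ht.2.trans haDT⟩
    have hd := hYd t
    rw [neg_one_smul, hW'eq _ (by linarith)] at hd
    exact hd
  -- ### Bernoulli-high and vortical along `[0, a + D]`
  have hhighY : ∀ t ∈ Icc 0 (a + D), h < selfSimilarBernoulli γ 0 V P' (Y t) := by
    intro t ht
    have hmono := bernoulli_le_of_arc hprof hγ2.le ht.1 (fun s hs => hYV s ⟨hs.1, le_trans hs.2 ht.2⟩)
    rw [hY0] at hmono
    exact lt_of_lt_of_le hhy hmono
  have hvortY : ∀ t ∈ Icc 0 (a + D), curl V (Y t) ≠ 0 := by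
    intro t ht
    have h0 : curl V (Y 0) ≠ 0 := by rw [hY0]; exact hy
    exact OutflowDive.vorticityTransport ρ hρ hρh V P' hprof t ht.1 Y
      (fun s hs => hYV s ⟨hs.1, le_trans hs.2 ht.2⟩) h0
  -- ### on the window the arc is far, hence fast: `‖W(Y)‖ ≥ w₀`
  have haD' : a ≤ a + D := le_add_of_nonneg_right hD
  have hsub : Icc a (a + D) ⊆ Icc 0 (a + D) := fun s hs => ⟨ha.trans hs.1, hs.2⟩
  have hfast : ∀ t ∈ Icc a (a + D), w₀ ^ 2 ≤ ‖selfSimilarTransport γ 0 V (Y t)‖ ^ 2 := by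
    intro t ht
    have hw := hnohov (Y t) (hnot t ht) (hhighY t (hsub ht)) (hvortY t (hsub ht))
    exact pow_le_pow_left₀ hw₀.le hw 2
  -- ### the Bernoulli gain on the window
  have hYV' : ∀ t ∈ Icc a (a + D), HasDerivAt Y ((-1 : ℝ) • selfSimilarTransport γ 0 V (Y t)) t := by
    intro t ht; rw [neg_one_smul]; exact hYV t (hsub ht)
  have hident := NeedleClock.bernoulli_comp_sub_eq_of_Icc hprof (s := (-1 : ℝ)) haD' hYV'
  have hWc : Continuous (selfSimilarTransport γ 0 V) := by
    have e : selfSimilarTransport γ 0 V = fun y => γ • (y - 0) + V y := rfl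
    rw [e]; exact ((continuous_id.sub continuous_const).const_smul γ).add hU2.continuous
  have hint : IntervalIntegrable (fun t => ‖selfSimilarTransport γ 0 V (Y t)‖ ^ 2) volume a (a + D) :=
    (((hWc.comp hYc).norm.pow 2).continuousOn).intervalIntegrable
  have hintge : w₀ ^ 2 * D ≤ ∫ t in a..(a + D), ‖selfSimilarTransport γ 0 V (Y t)‖ ^ 2 := by
    have h1 : ∫ _ in a..(a + D), w₀ ^ 2 = (a + D - a) * w₀ ^ 2 := by
      rw [intervalIntegral.integral_const, smul_eq_mul]
    have h2 := intervalIntegral.integral_mono_on haD' intervalIntegrable_const hint hfast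
    rw [h1] at h2; linarith only [h2]
  have hgrow : (1 - 2 * γ) * (w₀ ^ 2 * D) ≤
      selfSimilarBernoulli γ 0 V P' (Y (a + D)) - selfSimilarBernoulli γ 0 V P' (Y a) := by
    rw [hident]
    have e : (-1 : ℝ) * (2 * γ - 1) = 1 - 2 * γ := by ring
    rw [e]
    exact mul_le_mul_of_nonneg_left hintge h12γ.le
  -- ### the bound `m` at the endpoint, and the contradiction
  have hend : selfSimilarBernoulli γ 0 V P' (Y (a + D)) ≤ m :=
    hbound (Y (a + D)) (hstay (a + D) ⟨ha.trans haD', haDT⟩) (hvortY (a + D) (right_mem_Icc.2 (ha.trans haD')))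
      (hhighY (a + D) (right_mem_Icc.2 (ha.trans haD')))
  have hstart : h < selfSimilarBernoulli γ 0 V P' (Y a) := hhighY a ⟨ha, haD'⟩
  have hmD' : m - h ≤ (1 - 2 * γ) * w₀ ^ 2 * D := hmD
  have : (1 - 2 * γ) * w₀ ^ 2 * D = (1 - 2 * γ) * (w₀ ^ 2 * D) := by ring
  rw [this] at hmD'
  linarith

end LastExit

end Summit.NavierStokesRegularity.NavierStokesRegularity.Theorems.PowerGaugeEulerLiouville

end
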